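import Summits.CriticalPhenomena.PercolationContinuityZ3.Theorems.PercNearOneGluingNoHeavyLowerTailMajorityGluingQCertSymParts
import HarnessLib

/-!
# Part 16 of 18 of the orbit certificate of the cell `(12,7)` at `c = 157/100`: data and digest (lane prim-rate, constants-miner 1, gen 36; generated by cert/mksym.py)

Support file for the closed crux `NoHeavyLowerTail` (stmt-CriticalPhenomena-4575), majority-gluing line.  The symmetrised certificate of the cell `(12,7)`
(kit j286395, symcert.py) is checked IN PARTS (`…MajorityGluingQCertSymParts`): this file holds part 16 (1 multiplier terms, 1 marginal slacks,
0 rows, 0 squares; 3636 contributions) and its DIGEST `twelveSevenSymP16D` (51 orbit keys), verified by `decide +kernel` (`twelveSevenSymP16_digest`).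
The parts are glued in `…MajorityGluingQCertSymTwelveSeven`.  No sorries. [cite: VandenbergKahn2001, Thm 1.2 (p. 123)]
-/

namespace Summit.CriticalPhenomena.PercolationContinuityZ3.Theorems

namespace HubOnly
namespace QCert

/-- Row representatives of part 16: `(A, X, B, Y, n, masks of f(A,X), f(B,Y), f(A∪B,X∩Y), f(∅,X∪Y))`. -/
def twelveSevenSymP16Rows : List RowE :=
  []

/-- Square representatives of part 16: `(a, b, n, mask₁, mask₂)`. -/
def twelveSevenSymP16Sqs : List SqE :=
  []

/-- **Part 16** of the `(12,7)` orbit certificate at `157/100`. -/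
def twelveSevenSymP16 : SymCert :=
  ⟨⟨12, 7, 157, 100, 1, [], [], []⟩,
    [(2047, 180462735315278592)],
    [(0, 255, 33267269201632399360)],
    [twelveSevenSymP16Rows], [twelveSevenSymP16Sqs]⟩

/-- The digest of part 16: `(orbit key, coefficient total)` in increasing key order (computed by cert/mksym.py, verified below). -/
def twelveSevenSymP16D : List (ℕ × ℤ) :=
  [((4352 : ℕ), (33267269201632399360 : ℤ)), (12546, 232870884411426795520), (12800, 133069076806529597440), (28934, 698612653234280386560), 
    (29186, 931483537645707182080), (29696, 199603615209794396160), (61710, 1164354422057133977600), (61958, 2794450612937121546240), 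
    (62466, 1397225306468560773120), (63488, 133069076806529597440), (127262, 1164354422057133977600), (127502, 4657417688228535910400), 
    (128006, 4191675919405682319360), (129026, 931483537645707182080), (131072, 33267269201632399360), (258366, 698612653234280386560), 
    (258590, 4657417688228535910400), (259086, 6986126532342803865600), (260102, 2794450612937121546240), (262146, 232870884411426795520), 
    (520574, 232870884411426795520), (520766, 2794450612937121546240), (521246, 6986126532342803865600), (522254, 4657417688228535910400), 
    (522366, -5955270265404193536000), (524294, 698612653234280386560), (524350, -8337378371565870950400), (1044990, 33267269201632399360), 
    (1045118, 931483537645707182080), (1045246, 133069076806529597440), (1045566, 4191675919405682319360), (1045630, 1397225306468560773120), 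
    (1045758, 199603615209794396160), (1046558, 4657417688228535910400), (1046590, 2794450612937121546240), (1046654, 931483537645707182080), 
    (1046782, -2844566055895567170560), (1048590, 1164354422057133977600), (1048606, 1164354422057133977600), (1048638, 698612653234280386560), 
    (1048702, -5722399380992766740480), (1048830, 33267269201632399360), (2095614, -992545044234032256000), (2097406, -2977635132702096768000), 
    (4193278, -198509008846806451200), (4194814, -992545044234032256000), (8388606, -18046273531527859200), (8389630, -198509008846806451200), 
    (8390654, -18046273531527859200), (16781567, -33267269201632399360), (16783359, 28332649444498738944)]

/-- **The digest of part 16 is `twelveSevenSymP16D`** (kernel evaluation of the part's 3636 contributions). -/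
theorem twelveSevenSymP16_digest : twelveSevenSymP16.digest 20 = twelveSevenSymP16D := by
  decide +kernel

end QCert
end HubOnly

end Summit.CriticalPhenomena.PercolationContinuityZ3.Theorems
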